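import Summits.ABC.ABC.Theorems.CongruentialReceptacleTameLocalReceptacleKeyCellDefs
import Literature.NumberTheory.Sieve.SmoothZetaDecayLongRangeScale
import Literature.NumberTheory.LFunctions.RHWave0GRHProofs

/-!
# Crux `CongruentialReceptacle.TameLocalReceptacle` (stmt-ABC-14354), line `grh-friable-cell-resolution`:
# stub `stub_zetaDecay_of_grh` (GRH ⇒ long-range decay of the friable zeta ratio)

Registered stub of the checked skeleton `Cruxes/TameLocalReceptacle/Lines/grh_friable_cell_resolution.lean`
(lead `prover-line-stmt-ABC-14354-a1-0`): `GeneralizedRiemannHypothesis → FriableZetaLongRangeDecay`, i.e. under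
GRH there are `c > 0`, `x₀` with `‖ζ(α + it, y)‖/ζ(α, y) ≤ exp(−c log x/log y)` for `x ≥ x₀`,
`(log x)^4 ≤ y ≤ exp((log x)^{1/5})`, `α = α(x, y)` the saddle point and `3 ≤ |t| ≤ y¹²`
(`Literature.NumberTheory.Sieve.FriableZetaLongRangeDecay`; Hildebrand–Tenenbaum, Trans. AMS 296 (1986),
Lemma 8 (ii) (3.16) in that range).

This is a DERIVATION from the tree, not a vendored fact: GRH ⇒ RH (`GeneralizedRiemannHypothesis.riemannHypothesis`)
⇒ scale-wise zero-freeness of `ζ₁` (`ZetaScale.scaleZeroFree_of_riemannHypothesis`) ⇒ the twisted prime number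
theorem for the principal character at scale `X = y¹²` (`ZetaScale.twisted_sum_estimate_one_of_scale`) ⇒ Abel
summation `‖∑_{P < p ≤ y} log p · p^{-α-it}‖ ≤ y^{1-α}(2/|t| + o(1))` (`ZetaScaleTwistedLogPrimeSum.lean`,
H–T Lemma 6 over primes) ⇒ the decay sum `W = Σ_{p ≤ y} p^{-α}(1 − cos(t log p)) ≥ u/10`
(`SmoothZetaDecayLongRangeScale.lean`: `A = Σ log p · p^{-α} ≥ log x − 30` by the saddle-point equation,
`A ≥ (19/20) y^{1-α}` by the prime number theorem, the primes below the Vinogradov–Korobov window by Chebyshev)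
⇒ `|ζ(α+it, y)|/ζ(α, y) ≤ e^{-W}` (`norm_smoothZetaC_le_mul_exp_neg_decaySum`).  The only hypothesis is GRH
(indeed only RH for `ζ` is used).
-/

-- `Summit.<Summit>.<Problem>` is the mandated summit-side namespace (CONVENTIONS §2); for the
-- single-conjunct summit `ABC` the two coincide, so the duplicate `ABC.ABC` is deliberate.
set_option linter.dupNamespace false

noncomputable section

namespace Summit.ABC.ABC.Theorems.TameLocalReceptacle

open Literature.NumberTheory.LFunctions Literature.NumberTheory.Sieve

/-- **Stub `stub_zetaDecay_of_grh` (Hildebrand–Tenenbaum 1986, Lemma 8 (ii) (3.16) for `3 ≤ |t| ≤ y¹²`,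
derived in the tree under RH).**  Under the Generalized Riemann Hypothesis the friable zeta ratio decays:
`FriableZetaLongRangeDecay` (`Literature.NumberTheory.Sieve.friableZetaLongRangeDecay_of_riemannHypothesis`
applied to `GeneralizedRiemannHypothesis.riemannHypothesis`). [cite: HildebrandTenenbaum1986, Lemma 8 (ii) (3.16)] -/
theorem stub_zetaDecay_of_grh : GeneralizedRiemannHypothesis → FriableZetaLongRangeDecay :=
  fun hGRH ↦ friableZetaLongRangeDecay_of_riemannHypothesis hGRH.riemannHypothesis

end Summit.ABC.ABC.Theorems.TameLocalReceptacle

end
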